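import Literature.Probability.RandomPlanarGeometry.RestrictionMeasuresFiveEighthsAssembly
import HarnessLib

/-!
# [LSW] Prop. 8.1, first sentence (`exists_isRightRestrictionMeasure`): the superposition step iterated, and the discharge modulo the four leaves of Thm. 8.4

Proof-only sibling of `OneSidedRestrictionFacts` (no new definition, no new named fact) for the
named fact `Literature.Probability.RandomPlanarGeometry.exists_isRightRestrictionMeasure`, after

* G. F. Lawler, O. Schramm, W. Werner, *Conformal restriction: the chordal case*, J. Amer. Math.
  Soc. **16** (2003) 917–955, arXiv:math/0209343 (**[LSW]**), §8.2, Prop. 8.1, first sentence: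
  "The right-sided restriction measures `P⁺_α` exist for all `α > 0`."

The printed proof (§8.2, the two sentences preceding Prop. 8.1) has two steps: (a) "Reflected
Brownian excursions therefore show that for all `α ∈ (0, 1]`, the right-sided restriction measure
with exponent `α` exists." (b) "Taking unions of independent hulls which satisfy the right-sided
restriction property, yields a realization of another right-sided restriction measure (and the
exponent add up)." Step (b) for two independent samples is the tree's
`IsRightRestrictionMeasure.fillUnion` (`SLEKappaRhoAsymmetry`: `F^{ℝ₊}_ℍ(K₁ ∪ K₂) ~ P⁺_{α+β}` for
independent `K₁ ~ P⁺_α`, `K₂ ~ P⁺_β`). Contents, everything PROVED: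

* `Literature.Probability.RandomPlanarGeometry.exists_isRightRestrictionMeasure_of_exists_lt` —
  step (b) iterated: if `P⁺_α` exists for every `α` in an initial interval `(0, ε)`, it exists
  for every `α > 0` (`α = (n + 1) · α/(n + 1)` with `α/(n + 1) < ε`; `(n + 1)`-fold filled unions);
* `Literature.Probability.RandomPlanarGeometry.exists_isRightRestrictionMeasure_of_exists_lt_five_eighths` —
  hence the bundled Cor. 8.6 input `exists_isRightRestrictionMeasure_lt_five_eighths`
  (`OneSidedRestriction`: for `0 < α < 5/8`, `P⁺_α` exists and `P⁺_α{i ∉ K} > 1/2`) alone implies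
  the fact (complementing `exists_isRightRestrictionMeasure_lt_five_eighths_of_facts` and
  `exists_isRightRestrictionMeasure_of_lt_five_eighths` of `OneSidedRestrictionFacts`, which go
  the other way and give existence below `5/8` only);
* `Literature.Probability.RandomPlanarGeometry.exists_isRightRestrictionMeasure_of_four_leaves` —
  the fact from the four remaining printed leaves of the tree's SLE(8/3, ρ) proof of [LSW]
  Thm. 8.4 (`SLEKappaRho.isRightRestrictionMeasure_fill_of_four_leaves`,
  `RestrictionMeasuresFiveEighthsAssembly`; then `exists_isRightRestrictionMeasure_of_sleKappaRho`,
  `SLEKappaRho`: `P⁺_α` is the law of `F^{ℝ₊}_ℍ(cl K_∞)` for SLE(8/3, ρ(α))): the one-sided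
  martingale of Lemmas 8.9–8.10 (`SLEKappaRho.exists_isOneSidedMartingale`), Lemma 6.2
  (`Loewner.restrictionDeriv_exitTime_gt`), Lemma 6.3 (`IsSmoothHull.restrictionDerivVanishesAtHit`)
  and Lemma 8.3 (2) on the positive axis (`SLEKappaRho.swallowingTime_ofReal_pos`). The
  discharge `exists_isRightRestrictionMeasure_holds` is this theorem applied to the four
  `_holds` theorems of those named facts, once they exist.

Not in the tree: step (a) (reflected Brownian excursions, §8.2), which would be an alternative
to the four leaves for the initial interval `(0, 1]`. This file cannot be appended to
`OneSidedRestrictionFacts.lean`, which `SLEKappaRho` imports (import cycle); hence the sibling.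

Mathlib: `exists_nat_gt`, `mul_div_cancel₀`. Tree: `IsRightRestrictionMeasure.fillUnion`,
`exists_isRightRestrictionMeasure_of_sleKappaRho`,
`SLEKappaRho.isRightRestrictionMeasure_fill_of_four_leaves`.
-/

noncomputable section

open _root_.MeasureTheory

namespace Literature.Probability.RandomPlanarGeometry

/-! ### Step (b) of the printed proof, iterated: existence on an initial interval suffices -/

/-- **Existence of `P⁺_α` on an initial interval gives existence for all `α > 0`** ([LSW] §8.2,
the sentence preceding Prop. 8.1: "Taking unions of independent hulls which satisfy the
right-sided restriction property, yields a realization of another right-sided restriction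
measure (and the exponent add up)"; Prop. 8.1: "If `α = a_1 + ⋯ + a_k` […] then `F^{ℝ₊}_ℍ`
applied to the union of `k` independent RBEs […] has law `P⁺_α`"): if for some `ε > 0` the
right-sided restriction measure with exponent `α` exists for every `α ∈ (0, ε)`, then it exists
for every `α > 0` — write `α = (n + 1) b` with `b = α/(n + 1) < ε` and fill the union of `n + 1`
independent samples of `P⁺_b`, two at a time (`IsRightRestrictionMeasure.fillUnion`).
[cite: LawlerSchrammWerner2003Restriction, Prop. 8.1 and the sentence preceding it (§8.2)] -/
theorem exists_isRightRestrictionMeasure_of_exists_lt {ε : ℝ} (hε : 0 < ε)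
    (h : ∀ α : ℝ, 0 < α → α < ε → ∃ Q : Measure RightConfig, IsRightRestrictionMeasure α Q) :
    exists_isRightRestrictionMeasure := by
  intro α hα
  obtain ⟨n, hn⟩ := exists_nat_gt (α / ε)
  have hn1 : (0 : ℝ) < (n : ℝ) + 1 := by positivity
  -- the exponent `b = α / (n + 1) ∈ (0, ε)` with `(n + 1) b = α`
  obtain ⟨b, hb0, hbε, hbα⟩ : ∃ b : ℝ, 0 < b ∧ b < ε ∧ ((n : ℝ) + 1) * b = α := by
    refine ⟨α / ((n : ℝ) + 1), div_pos hα hn1, ?_, mul_div_cancel₀ α hn1.ne'⟩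
    rw [div_lt_iff₀ hn1]
    have hlt : α < (n : ℝ) * ε := (div_lt_iff₀ hε).1 hn
    nlinarith
  -- `P⁺_{(k + 1) b}` exists for every `k`, by induction on `k`
  have key : ∀ k : ℕ, ∃ Q : Measure RightConfig, IsRightRestrictionMeasure (((k : ℝ) + 1) * b) Q := by
    intro k
    induction k with
    | zero =>
      obtain ⟨Q, hQ⟩ := h b hb0 hbε
      exact ⟨Q, by simpa using hQ⟩
    | succ k ih =>
      obtain ⟨Q₁, hQ₁⟩ := ih
      obtain ⟨Q₂, hQ₂⟩ := h b hb0 hbε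
      have heq : (((k + 1 : ℕ) : ℝ) + 1) * b = ((k : ℝ) + 1) * b + b := by
        push_cast
        ring
      rw [heq]
      exact ⟨_, hQ₁.fillUnion hQ₂⟩
  obtain ⟨Q, hQ⟩ := key n
  rw [hbα] at hQ
  exact ⟨Q, hQ⟩

/-- **The bundled Cor. 8.6 input implies [LSW] Prop. 8.1, first sentence**: if `P⁺_α` exists
(with `P⁺_α{i ∉ K} > 1/2`) for all `0 < α < 5/8` (`exists_isRightRestrictionMeasure_lt_five_eighths`),
then `P⁺_α` exists for all `α > 0`, by superposition from the initial interval `(0, 5/8)`.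
[cite: LawlerSchrammWerner2003Restriction, Prop. 8.1 (§8.2) with Thm. 8.4 (p. 37)] -/
theorem exists_isRightRestrictionMeasure_of_exists_lt_five_eighths
    (h : exists_isRightRestrictionMeasure_lt_five_eighths) : exists_isRightRestrictionMeasure :=
  exists_isRightRestrictionMeasure_of_exists_lt (by norm_num : (0 : ℝ) < 5 / 8)
    fun _ hα hlt ↦ exists_isRightRestrictionMeasure_of_lt_five_eighths h hα hlt

/-! ### The discharge modulo the four remaining leaves of Thm. 8.4 -/

/-- **[LSW] Prop. 8.1, first sentence, from the four remaining leaves of the tree's proof of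
Thm. 8.4** ("The right-sided restriction measures `P⁺_α` exist for all `α > 0`"; here `P⁺_α` is
the law of `F^{ℝ₊}_ℍ(cl K_∞)` for SLE(8/3, ρ(α)), Thm. 8.4 p. 37, "when `ρ` spans `(−2, ∞)`, `α`
spans `(0, ∞)`"): given the one-sided martingale of Lemmas 8.9–8.10 (`hM`), Lemma 6.2 (`h62`),
Lemma 6.3 (`h63`) and Lemma 8.3 (2) on the positive axis (`h83`), the named fact
`exists_isRightRestrictionMeasure` holds. Its discharge `exists_isRightRestrictionMeasure_holds`
is this theorem fed with the four `_holds` theorems.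
[cite: LawlerSchrammWerner2003Restriction, Prop. 8.1 (§8.2) via Thm. 8.4 (p. 37) and its proof (§8.4)] -/
theorem exists_isRightRestrictionMeasure_of_four_leaves
    (hM : SLEKappaRho.exists_isOneSidedMartingale)
    (h62 : Loewner.restrictionDeriv_exitTime_gt) (h63 : IsSmoothHull.restrictionDerivVanishesAtHit)
    (h83 : SLEKappaRho.swallowingTime_ofReal_pos) : exists_isRightRestrictionMeasure :=
  exists_isRightRestrictionMeasure_of_sleKappaRho
    (SLEKappaRho.isRightRestrictionMeasure_fill_of_four_leaves hM h62 h63 h83)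

end Literature.Probability.RandomPlanarGeometry

end
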